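import Summits.CriticalPhenomena.PercolationContinuityZ3.Theorems.PercNearOneGluingNoHeavyConstsClusterSquareQuadClash
import Summits.CriticalPhenomena.PercolationContinuityZ3.Theorems.PercNearOneGluingNoHeavyConstsClusterSquareSeparated
import HarnessLib

/-!
# No quadruple clash when no cluster of `a` has four boundary vertices: `K₂,₃`, the wheel rooted on the rim, …

builds on p205010 (kernel theorem, internal audit signed; external expert review pending)

PAPER-2 track "percolation constants", part (ii), seat `prim-consts-1`, gen 18 (lane index
`run/shared/lean/prim/consts/CONSTANTS.md`, row A19; memo `FROM-prim-consts-1-g18-QUAD-CLASH.md`).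
Support file for the crux `NoHeavyLowerTail` (stmt-CriticalPhenomena-4575; `--supports`).  Theorems only; no sorries.

The four vertices `y ∈ C_b(ω) ∩ C_c(η')`, `y' ∈ C_c(ω) ∩ C_b(η')`, `z ∈ C_b(ω) ∩ C_b(η')`, `z' ∈ C_c(ω) ∩ C_c(η')` of a quadruple clash
(`…ConstsClusterSquareQuadClash.lean`) are pairwise distinct (`b ↮ c` in `ω` and in `η'`), lie outside `K = C_a(ω)` (`a ↮ b`, `a ↮ c`)
and are joined to `K` by positive pairs.  So the simplest sufficient condition for "no quadruple clash" is purely about vertex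
boundaries (`Consts.not_quadClash_of_boundary_le_three`): **no `H`-connected `K ∋ a` with `b, c ∉ K` has four distinct vertices
outside `K` with `H`-neighbours in `K`** (`H` any graph containing the positive pairs).  CSQ, DUU at `(a; b, c)` and TS for `{a, b, c}`
follow (`Consts.clusterSquare_le_sq_of_boundary_le_three`, `Consts.sq_real_split_le_of_boundary_le_three`,
`Consts.tripleSplit_of_boundary_le_three`).  Examples: `K₂,₃` at EVERY placement of the three terminals (where "no double clash" fails
when `a, b, c` lie in the 3-part), the wheel `W₄` rooted at a rim vertex with the hub a terminal (so, with `…ClusterSquareNDC`, TS for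
every triple of every weighted `W₄`), every graph in which all clusters of `a` avoiding `b, c` have at most three boundary vertices.
References: N. Gladkov, arXiv:2408.08457v2 (2024), Thm. 4.3, Def. 4.2, Lemma 3.1, Example 2.5, Thm. 5.2.
-/

noncomputable section

open Classical

namespace Summit.CriticalPhenomena.PercolationContinuityZ3.Theorems

open MeasureTheory Finset Literature.Probability.LatticeModels Literature.Probability.Percolation
open Literature.Probability.Percolation.DecisionTree Literature.Probability.Percolation.BHK2006
open Literature.Probability.Percolation.TargetExploration Literature.Probability.Percolation.ClusterConditioning

namespace Consts

section General

variable {V : Type*}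

/-- **The four vertices of a quadruple clash are pairwise distinct, outside `C_a(ω)`, and adjacent to it**: so "no `H`-connected
`K ∋ a` avoiding `b, c` sees four distinct outside vertices through positive pairs" excludes quadruple clashes.  `H` carries the
positive pairs; the hypothesis asks, for every `K ∋ a` with `b, c ∉ K`, `H`-connected from `a` (every `T ∋ a` closed under `H`-steps
into `K` contains `K`), that no four pairwise distinct vertices outside `K` have `H`-neighbours in `K`.  (`K₂,₃` at every placement,
the wheel `W₄` whenever the hub is a terminal and the root is on the rim, every cluster with at most three boundary vertices.)
[folklore; input for Gladkov2024, Thm. 4.3] -/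
theorem not_quadClash_of_boundary_le_three (H : SimpleGraph V) (w : Sym2 V → unitInterval) {a b c : V}
    (hH : ∀ u v, u ≠ v → (0 : ℝ) < w s(u, v) → H.Adj u v)
    (hK : ∀ (K : Set V) (v₁ v₂ v₃ v₄ : V), a ∈ K → b ∉ K → c ∉ K →
      (∀ T : Set V, a ∈ T → (∀ u x, u ∈ T → H.Adj u x → x ∈ K → x ∈ T) → K ⊆ T) →
      v₁ ∉ K → v₂ ∉ K → v₃ ∉ K → v₄ ∉ K →
      (∃ k, k ∈ K ∧ H.Adj k v₁) → (∃ k, k ∈ K ∧ H.Adj k v₂) → (∃ k, k ∈ K ∧ H.Adj k v₃) → (∃ k, k ∈ K ∧ H.Adj k v₄) →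
      v₁ ≠ v₂ → v₁ ≠ v₃ → v₁ ≠ v₄ → v₂ ≠ v₃ → v₂ ≠ v₄ → v₃ ≠ v₄ → False)
    {ω η : Set (Sym2 V)} (hω : ∀ e ∈ ω, (0 : ℝ) < w e) (_hη : ∀ e ∈ η, (0 : ℝ) < w e)
    (hab : ¬ (openGraph ω).Reachable a b) (hac : ¬ (openGraph ω).Reachable a c) (hbc : ¬ (openGraph ω).Reachable b c)
    (hbc' : ¬ (openGraph (η \ barOf {a} (setCl ω {a}))).Reachable b c) :
    ¬ ((∃ y k : V, (openGraph ω).Reachable a k ∧ (0 : ℝ) < w s(k, y) ∧ (openGraph ω).Reachable b y ∧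
          (openGraph (η \ barOf {a} (setCl ω {a}))).Reachable c y) ∧
       (∃ y k : V, (openGraph ω).Reachable a k ∧ (0 : ℝ) < w s(k, y) ∧ (openGraph ω).Reachable c y ∧
          (openGraph (η \ barOf {a} (setCl ω {a}))).Reachable b y) ∧
       (∃ y k : V, (openGraph ω).Reachable a k ∧ (0 : ℝ) < w s(k, y) ∧ (openGraph ω).Reachable b y ∧
          (openGraph (η \ barOf {a} (setCl ω {a}))).Reachable b y) ∧
       (∃ y k : V, (openGraph ω).Reachable a k ∧ (0 : ℝ) < w s(k, y) ∧ (openGraph ω).Reachable c y ∧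
          (openGraph (η \ barOf {a} (setCl ω {a}))).Reachable c y)) := by
  rintro ⟨⟨y, k, hk, hw, hby, hcy⟩, ⟨y', k', hk', hw', hcy', hby'⟩, ⟨z, l, hl, hwz, hbz, hbz'⟩, ⟨z', l', hl', hwz', hcz, hcz'⟩⟩
  set θ := η \ barOf {a} (setCl ω {a}) with hθdef
  set K : Set V := {x | (openGraph ω).Reachable a x} with hKdef
  have hadjH : ∀ (ξ : Set (Sym2 V)), (∀ e ∈ ξ, (0 : ℝ) < w e) → ∀ u v, (openGraph ξ).Adj u v → H.Adj u v := by
    intro ξ hξ u v huv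
    rw [openGraph_adj] at huv
    exact hH u v huv.2 (hξ _ huv.1)
  have hconn : ∀ T : Set V, a ∈ T → (∀ u x, u ∈ T → H.Adj u x → x ∈ K → x ∈ T) → K ⊆ T := by
    intro T haT hT x hx
    obtain ⟨X⟩ := id hx
    exact mem_of_openWalk_adm H T (fun z => z ∈ K) (fun u z hu huz hz => hT u z hu huz hz) (hadjH ω hω) X haT
      fun z hz => Or.inr (show (openGraph ω).Reachable a z from ⟨X.takeUntil z hz⟩)
  -- adjacency of the four vertices to `K` through positive pairs
  have hadj : ∀ {q v : V}, (openGraph ω).Reachable a q → (0 : ℝ) < w s(q, v) → v ∉ K → ∃ k, k ∈ K ∧ H.Adj k v :=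
    fun {q v} hq hqv hv => ⟨q, hq, hH q v (fun h => hv (h ▸ hq)) hqv⟩
  have hyK : y ∉ K := fun h => hab (h.trans hby.symm)
  have hyK' : y' ∉ K := fun h => hac (h.trans hcy'.symm)
  have hzK : z ∉ K := fun h => hab (h.trans hbz.symm)
  have hzK' : z' ∉ K := fun h => hac (h.trans hcz.symm)
  exact hK K y y' z z' (SimpleGraph.Reachable.refl a) hab hac hconn hyK hyK' hzK hzK' (hadj hk hw hyK) (hadj hk' hw' hyK')
    (hadj hl hwz hzK) (hadj hl' hwz' hzK')
    (fun h => hbc (hby.trans (by rw [h]; exact hcy'.symm)))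
    (fun h => hbc' (hbz'.trans (by rw [← h]; exact hcy.symm)))
    (fun h => hbc (hby.trans (by rw [h]; exact hcz.symm)))
    (fun h => hbc (hbz.trans (by rw [← h]; exact hcy'.symm)))
    (fun h => hbc' (hby'.trans (by rw [h]; exact hcz'.symm)))
    (fun h => hbc (hbz.trans (by rw [h]; exact hcz.symm)))

end General

/-! ### `Fin n` forms -/

/-- **TS for `{a, b, c}` when no `H`-connected cluster of `a` avoiding `b, c` sees four distinct outside vertices** (`H` ⊇ positive
pairs): `μ(a|b|c)² ≤ μ(a↮b)·μ(a↮c)·μ(b↮c)`.  Instances: `K₂,₃` at every placement; the wheel `W₄` rooted on the rim with the hub a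
terminal; every graph in which `a` has at most three vertices within distance… more precisely every rooted graph all of whose
`a`-clusters have at most three boundary vertices. [cite: Gladkov2024, Thm. 4.3 and Thm. 5.2; derived here] -/
theorem tripleSplit_of_boundary_le_three {n : ℕ} (w : Sym2 (Fin n) → unitInterval) (a b c : Fin n) (H : SimpleGraph (Fin n))
    (hH : ∀ u v, u ≠ v → (0 : ℝ) < w s(u, v) → H.Adj u v)
    (hK : ∀ (K : Set (Fin n)) (v₁ v₂ v₃ v₄ : Fin n), a ∈ K → b ∉ K → c ∉ K →
      (∀ T : Set (Fin n), a ∈ T → (∀ u x, u ∈ T → H.Adj u x → x ∈ K → x ∈ T) → K ⊆ T) →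
      v₁ ∉ K → v₂ ∉ K → v₃ ∉ K → v₄ ∉ K →
      (∃ k, k ∈ K ∧ H.Adj k v₁) → (∃ k, k ∈ K ∧ H.Adj k v₂) → (∃ k, k ∈ K ∧ H.Adj k v₃) → (∃ k, k ∈ K ∧ H.Adj k v₄) →
      v₁ ≠ v₂ → v₁ ≠ v₃ → v₁ ≠ v₄ → v₂ ≠ v₃ → v₂ ≠ v₄ → v₃ ≠ v₄ → False) :
    (prodBernoulli w).real ((openConn a b)ᶜ ∩ (openConn a c)ᶜ ∩ (openConn b c)ᶜ) ^ 2 ≤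
      (prodBernoulli w).real (openConn a b)ᶜ * (prodBernoulli w).real (openConn a c)ᶜ *
        (prodBernoulli w).real (openConn b c)ᶜ :=
  tripleSplit_of_noQuadClash_pos w a b c fun _ _ hω hη hab hac hbc hbc' =>
    not_quadClash_of_boundary_le_three H w hH hK hω hη hab hac hbc hbc'

/-- **CSQ at `(a; b, c)` under the same boundary hypothesis.** [cite: Gladkov2024, Thm. 4.3; derived here] -/
theorem clusterSquare_le_sq_of_boundary_le_three {n : ℕ} (w : Sym2 (Fin n) → unitInterval) (a b c : Fin n)
    (H : SimpleGraph (Fin n)) (hH : ∀ u v, u ≠ v → (0 : ℝ) < w s(u, v) → H.Adj u v)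
    (hK : ∀ (K : Set (Fin n)) (v₁ v₂ v₃ v₄ : Fin n), a ∈ K → b ∉ K → c ∉ K →
      (∀ T : Set (Fin n), a ∈ T → (∀ u x, u ∈ T → H.Adj u x → x ∈ K → x ∈ T) → K ⊆ T) →
      v₁ ∉ K → v₂ ∉ K → v₃ ∉ K → v₄ ∉ K →
      (∃ k, k ∈ K ∧ H.Adj k v₁) → (∃ k, k ∈ K ∧ H.Adj k v₂) → (∃ k, k ∈ K ∧ H.Adj k v₃) → (∃ k, k ∈ K ∧ H.Adj k v₄) →
      v₁ ≠ v₂ → v₁ ≠ v₃ → v₁ ≠ v₄ → v₂ ≠ v₃ → v₂ ≠ v₄ → v₃ ≠ v₄ → False) :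
    clusterSquare w a b c ≤ (prodBernoulli w).real (openConn b c)ᶜ ^ 2 :=
  clusterSquare_le_sq_of_noQuadClash_pos w a b c fun _ _ hω hη hab hac hbc hbc' =>
    not_quadClash_of_boundary_le_three H w hH hK hω hη hab hac hbc hbc'

/-- **DUU at `(a; b, c)` under the same boundary hypothesis.** [cite: Gladkov2024, Thm. 5.2 and Thm. 4.3; derived here] -/
theorem sq_real_split_le_of_boundary_le_three {n : ℕ} (w : Sym2 (Fin n) → unitInterval) (a b c : Fin n)
    (H : SimpleGraph (Fin n)) (hH : ∀ u v, u ≠ v → (0 : ℝ) < w s(u, v) → H.Adj u v)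
    (hK : ∀ (K : Set (Fin n)) (v₁ v₂ v₃ v₄ : Fin n), a ∈ K → b ∉ K → c ∉ K →
      (∀ T : Set (Fin n), a ∈ T → (∀ u x, u ∈ T → H.Adj u x → x ∈ K → x ∈ T) → K ⊆ T) →
      v₁ ∉ K → v₂ ∉ K → v₃ ∉ K → v₄ ∉ K →
      (∃ k, k ∈ K ∧ H.Adj k v₁) → (∃ k, k ∈ K ∧ H.Adj k v₂) → (∃ k, k ∈ K ∧ H.Adj k v₃) → (∃ k, k ∈ K ∧ H.Adj k v₄) →
      v₁ ≠ v₂ → v₁ ≠ v₃ → v₁ ≠ v₄ → v₂ ≠ v₃ → v₂ ≠ v₄ → v₃ ≠ v₄ → False) :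
    (prodBernoulli w).real ((openConn a b)ᶜ ∩ (openConn a c)ᶜ ∩ (openConn b c)ᶜ) ^ 2 ≤
      (prodBernoulli w).real ((openConn a b)ᶜ ∩ (openConn a c)ᶜ) * (prodBernoulli w).real (openConn b c)ᶜ ^ 2 :=
  sq_real_split_le_of_noQuadClash_pos w a b c fun _ _ hω hη hab hac hbc hbc' =>
    not_quadClash_of_boundary_le_three H w hH hK hω hη hab hac hbc hbc'

end Consts

end Summit.CriticalPhenomena.PercolationContinuityZ3.Theorems
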